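import Summits.Parity.GeneralizedHardyLittlewood.Theses.LinnikGallagherMV
import Literature.NumberTheory.Sieve.GoldbachLinnikGallagherExists

/-!
# Route `LinnikGallagherMV` — the `Assembly` item (stmt-Parity-20515)

`Assembly : PointwiseMajorArcsMV → GallagherLargeDeviationQual → MeanSquareCrude →
LinnikGallagherExists` — the aggregation of the pointwise major arcs along the power-of-two multiset
`n_ν = N − Σ2^(ν_i)` (good tuples by `𝔖(n) ≥ 2C₀`, the tuples with `p_N ∣ n_ν` by Pintz–Ruzsa II
Lemma 1) fed into Heath-Brown–Puchta's §6 frame `GoldbachLinnik.goldbach_linnik_with_of_direct_inputs`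
(`M = C₀c₀/4`, `c = 1 − θ/2` in Gallagher's lemma, `K` least with `Cλ^(K−2) < M`) — is, hypothesis
for hypothesis, the tree theorem `Literature.NumberTheory.Sieve.GoldbachLinnik.linnikGallagher_assembly`
(`Literature/NumberTheory/Sieve/GoldbachLinnikGallagherExists.lean`, p543960); this file closes the
item by applying it.  Honesty label of the route: a FORMALISATION floor rung (F-LGE) of Parity —
formalisation-first of Linnik 1953 / Gallagher 1975; no new mathematics, no value of `K`, never
distance-to-Goldbach.

References: P. X. Gallagher, Invent. Math. 29 (1975), Theorem 1 [Gallagher1975]; D. R. Heath-Brown,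
J.-C. Puchta, Asian J. Math. 6 (2002) §6 [HeathbrownPuchta2002].
-/

namespace Summit.Parity.GeneralizedHardyLittlewood.Theorems

/-- **`Assembly` PROVED** (item stmt-Parity-20515): the three analytic inputs of Gallagher's proof —
pointwise major arcs with the exceptional prime built in, Gallagher's large-deviation lemma
(qualitative) and the crude mean square — imply `∃ K, goldbach_linnik_with K`; the term is the
Literature theorem `GoldbachLinnik.linnikGallagher_assembly` applied to the three hypotheses (the
route decls unfold to its hypothesis types verbatim). [cite: Gallagher1975, Theorem 1;
HeathbrownPuchta2002, §6] -/
theorem linnikGallagherMV_assembly_proof :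
    Summit.Parity.GeneralizedHardyLittlewood.Theses.LinnikGallagherMV.Assembly :=
  fun h₁ h₂ h₃ => Literature.NumberTheory.Sieve.GoldbachLinnik.linnikGallagher_assembly h₁ h₂ h₃

end Summit.Parity.GeneralizedHardyLittlewood.Theorems
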